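import Summits.Ventures.LatticeQCDFlow.Scoring.BesselToeplitzAndreief
import Literature.RingTheory.SymmetricFunctions.SchurPolynomials
import HarnessLib

/-!
# Alternants at a torus point in Leibniz form, and the double expansion of `(Π e^{x cos θ_b}) a_α conj a_β`

HONEST FRAMING: exact (Metropolis-corrected) sampling algorithms for lattice gauge theory;
figures of merit are autocorrelation/cost numbers at stated couplings and volumes; no
continuum-physics claim.

Venture `LatticeQCDFlow` (cell pub-lqcd), sub-topic `Scoring`; FANOUT row 5 (`s0-sun-a`), GEN-23.
NEW WORK of the cell (placement rule).  Shared bookkeeping for the `U(N)` and `SU(N)` character-coefficient files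
(`UNCharacterCoefficients`, `SUNCharacterCoefficients`): for exponent vectors `α, β : Fin N → ℕ` and ANY phases
`θ : Fin N → ℝ` (free, or with one dependent phase as on the `SU(N)` torus),

* `alternant_cexp_eq_sum`: `a_α(e^{iθ}) = Σ_σ sgn σ Π_b e^{i α(σ⁻¹b) θ_b}` (the tree's `SchurPolynomials.alternant_eq_sum`
  at the point `z_b = e^{iθ_b}`), and its conjugate;
* `prod_cexp_cos_mul_alternant_mul_conj_alternant_eq_sum`: the double Leibniz expansion
  `(Π_b e^{x cos θ_b}) a_α(e^{iθ}) conj a_β(e^{iθ}) = Σ_{σ,τ} sgn σ sgn τ Π_b e^{x cos θ_b} e^{i(α(σ⁻¹b) − β(τ⁻¹b))θ_b}`;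
* `integrable_cube_weighted_term'`: each term `Π_b e^{x cos θ_b} e^{i m_b θ_b}` is integrable on the cube `(−π,π]^N`.

No `def`, no named fact, 0 sorry.
-/

noncomputable section

open Real MeasureTheory Finset Complex Equiv
open scoped ENNReal ComplexConjugate
open Literature.RingTheory.SymmetricFunctions.SymmPoly (alternant alternant_eq_sum)

namespace Summit.Ventures.LatticeQCDFlow.Scoring

variable {N : ℕ}

/-! ### 1. Alternants at the torus point in Leibniz form -/

/-- `a_α(e^{iθ}) = Σ_σ sgn σ Π_b e^{i α(σ⁻¹ b) θ_b}`. -/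
theorem alternant_cexp_eq_sum (α : Fin N → ℕ) (θ : Fin N → ℝ) :
    alternant (fun b => cexp (θ b * I)) α
      = ∑ σ : Perm (Fin N), ((Equiv.Perm.sign σ : ℤ) : ℂ) * ∏ b, cexp ((α (σ.symm b) : ℕ) * θ b * I) := by
  rw [alternant_eq_sum]
  refine Finset.sum_congr rfl fun σ _ => ?_
  congr 1
  rw [← Equiv.prod_comp σ (fun b => cexp ((α (σ.symm b) : ℕ) * θ b * I))]
  refine Finset.prod_congr rfl fun i _ => ?_
  rw [← Complex.exp_nat_mul, Equiv.symm_apply_apply]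
  ring_nf

/-- `conj a_β(e^{iθ}) = Σ_τ sgn τ Π_b e^{−i β(τ⁻¹ b) θ_b}`. -/
theorem conj_alternant_cexp_eq_sum (β : Fin N → ℕ) (θ : Fin N → ℝ) :
    conj (alternant (fun b => cexp (θ b * I)) β)
      = ∑ τ : Perm (Fin N), ((Equiv.Perm.sign τ : ℤ) : ℂ) * ∏ b, cexp (-((β (τ.symm b) : ℕ) * θ b * I)) := by
  rw [alternant_cexp_eq_sum, map_sum]
  refine Finset.sum_congr rfl fun τ _ => ?_
  rw [map_mul, map_intCast, map_prod]
  congr 1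
  refine Finset.prod_congr rfl fun b _ => ?_
  rw [← Complex.exp_conj, map_mul, map_mul, map_natCast, Complex.conj_ofReal, Complex.conj_I]
  ring_nf

/-- The double Leibniz expansion of `(Π_b e^{x cos θ_b}) a_α conj a_β`. -/
theorem prod_cexp_cos_mul_alternant_mul_conj_alternant_eq_sum (x : ℝ) (α β : Fin N → ℕ) (θ : Fin N → ℝ) :
    (∏ b, cexp ((x : ℂ) * Real.cos (θ b))) * (alternant (fun b => cexp (θ b * I)) α *
        conj (alternant (fun b => cexp (θ b * I)) β))
      = ∑ σ : Perm (Fin N), ∑ τ : Perm (Fin N), ((Equiv.Perm.sign σ : ℤ) : ℂ) * ((Equiv.Perm.sign τ : ℤ) : ℂ) *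
          ∏ b, (cexp ((x : ℂ) * Real.cos (θ b)) *
            cexp ((((α (σ.symm b) : ℕ) : ℤ) - ((β (τ.symm b) : ℕ) : ℤ) : ℤ) * θ b * I)) := by
  rw [alternant_cexp_eq_sum, conj_alternant_cexp_eq_sum, Finset.sum_mul_sum, Finset.mul_sum]
  refine Finset.sum_congr rfl fun σ _ => ?_
  rw [Finset.mul_sum]
  refine Finset.sum_congr rfl fun τ _ => ?_
  rw [Finset.prod_mul_distrib, mul_mul_mul_comm, ← Finset.prod_mul_distrib]
  have h : ∀ b, cexp ((α (σ.symm b) : ℕ) * θ b * I) * cexp (-((β (τ.symm b) : ℕ) * θ b * I))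
      = cexp ((((α (σ.symm b) : ℕ) : ℤ) - ((β (τ.symm b) : ℕ) : ℤ) : ℤ) * θ b * I) := by
    intro b
    rw [← Complex.exp_add]
    congr 1
    push_cast
    ring
  simp_rw [h]
  ring

/-- Each weighted term is integrable on the cube. -/
theorem integrable_cube_weighted_term' (x : ℝ) (m : Fin N → ℤ) :
    Integrable (fun θ : Fin N → ℝ => ∏ b, (cexp ((x : ℂ) * Real.cos (θ b)) * cexp ((m b : ℂ) * θ b * I)))
      (Measure.pi fun _ : Fin N => (volume : Measure ℝ).restrict (Set.Ioc (-π) π)) := by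
  refine Integrable.mono' (integrable_const ((Real.exp |x|) ^ N)) ?_ (Filter.Eventually.of_forall fun θ => ?_)
  · exact (continuous_finsetProd _ fun b _ => by fun_prop).aestronglyMeasurable
  · rw [norm_prod]
    calc ∏ b, ‖cexp ((x : ℂ) * Real.cos (θ b)) * cexp ((m b : ℂ) * θ b * I)‖ ≤ ∏ _b : Fin N, Real.exp |x| :=
          Finset.prod_le_prod (fun b _ => norm_nonneg _) fun b _ => ?_
      _ = Real.exp |x| ^ N := by rw [Finset.prod_const, Finset.card_univ, Fintype.card_fin]
    rw [norm_mul, show (m b : ℂ) * (θ b : ℂ) * I = (((m b : ℝ) * θ b : ℝ) : ℂ) * I by push_cast; ring,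
      Complex.norm_exp_ofReal_mul_I, mul_one,
      show (x : ℂ) * (Real.cos (θ b) : ℂ) = ((x * Real.cos (θ b) : ℝ) : ℂ) by push_cast; ring,
      Complex.norm_exp_ofReal, Real.exp_le_exp]
    calc x * Real.cos (θ b) ≤ |x * Real.cos (θ b)| := le_abs_self _
      _ = |x| * |Real.cos (θ b)| := abs_mul _ _
      _ ≤ |x| * 1 := mul_le_mul_of_nonneg_left (Real.abs_cos_le_one _) (abs_nonneg _)
      _ = |x| := mul_one _

end Summit.Ventures.LatticeQCDFlow.Scoring
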